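import Summits.PneNP.PneNP.Theorems.SymmetryBudgetWindowBarrierEntropyGame
import Summits.PneNP.PneNP.Theorems.WindowBarrier.Negative.ProbeCount

/-!
# The entropy game has teeth: equal edge counts (sanity file for `…EntropyGame.lean`)

Dichotomy `WindowBarrier` stmt-PneNP-2145 / `NoHiddenOrder` stmt-PneNP-14781, route
`PneNP/SymmetryBudget`.  A first CONSEQUENCE of an entropy game, recorded to show that the
Duplicator condition `CosetGame.EntropyGame K G H` of `SymmetryBudgetWindowBarrierEntropyGame.lean`
is a genuine similarity and not satisfiable for trivial reasons: with `K₀` the constant of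
`CosetGame.eval_eq_of_entropyGame` at rate `c = 3`, an entropy-`K₀` game forces `|E(G)| = |E(H)|`
(`CosetGame.card_edgeFinset_eq_of_entropyGame`).  The witness circuits are the disprover's symmetric
probe-count circuits `[t ≤ #{(u,v) | u ~ v}]` (`hasSymCircuit_probeCount`, size `n² + 3 ≤ 2^{3n}`).
Together with `CosetGame.EntropyGame.ofIso` (isomorphic pairs have games for every `K`) this brackets
the notion between isomorphism and "same number of edges"; every further symmetric statistic of size
`2^{O(n)}` (degrees, subgraph counts over bounded-entropy partitions, …) is forced the same way.
-/

-- `Summit.PneNP.PneNP.…` duplicates `PneNP` BY DESIGN (single-problem summit).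
set_option linter.dupNamespace false

namespace Summit.PneNP.PneNP.Theorems

open Finset Literature.Computability.Complexity Literature.ModelTheory.FiniteModelTheory
open Summit.PneNP.WindowBarrier.Negative (probeCount hasSymCircuit_probeCount)

namespace CosetGame

variable {n : ℕ}

/-! ### The entropy game has teeth: already the game for rate `c = 3` forces equal edge counts -/

/-- The probe family reading every ordered pair of vertices once (index `a ↦ (a / n, a % n)`). -/
def pairProbe (n : ℕ) : Fin (n * n) → Fin 1 → Fin n × Fin n := fun a _ => finProdFinEquiv.symm a

/-- The all-pairs probe family is equivariant under every vertex permutation (`ρ` permutes the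
pairs). -/
theorem pairProbe_equivariant (ρ : Equiv.Perm (Fin n)) :
    ∃ θ : Equiv.Perm (Fin (n * n)), ∀ (a : Fin (n * n)) (k : Fin 1),
      (ρ (pairProbe n a k).1, ρ (pairProbe n a k).2) = pairProbe n (θ a) k := by
  refine ⟨finProdFinEquiv.symm.trans ((Equiv.prodCongr ρ ρ).trans finProdFinEquiv), fun a k => ?_⟩
  simp only [pairProbe, Equiv.trans_apply, Equiv.symm_apply_apply, Equiv.prodCongr_apply, Prod.map]

/-- On an adjacency matrix the all-pairs probe count is the number of ordered adjacent pairs,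
`2 · |E(G)|`. -/
theorem probeCount_pairProbe (G : SimpleGraph (Fin n)) [DecidableRel G.Adj] :
    probeCount (pairProbe n) (adjInput G) = 2 * G.edgeFinset.card := by
  rw [SimpleGraph.two_mul_card_edgeFinset]
  unfold probeCount GateFn.numOnes
  refine Finset.card_bij' (fun a _ => finProdFinEquiv.symm a) (fun q _ => finProdFinEquiv q)
    (fun a ha => ?_) (fun q hq => ?_) (fun a _ => finProdFinEquiv.apply_symm_apply a)
    (fun q _ => finProdFinEquiv.symm_apply_apply q)
  · simp only [Finset.mem_filter, Finset.mem_univ, true_and, decide_eq_true_eq] at ha ⊢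
    have h := ha 0
    simpa [pairProbe, adjInput] using h
  · simp only [Finset.mem_filter, Finset.mem_univ, true_and, decide_eq_true_eq] at hq ⊢
    intro k
    simpa [pairProbe, adjInput] using hq

/-- `n² + 3 ≤ 2^{3n}` for `n ≥ 1` (the size of the all-pairs probe-count circuit fits rate 3). -/
theorem sq_add_three_le_two_pow (hn : 1 ≤ n) : n * n + 3 ≤ 2 ^ (3 * n) := by
  have h1 : n ≤ 2 ^ n := Nat.lt_two_pow_self.le
  have hsq : n * n ≤ 2 ^ (2 * n) := by
    rw [two_mul, pow_add]
    exact Nat.mul_le_mul h1 h1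
  have h4 : 4 ≤ 2 ^ (2 * n) := by
    calc (4 : ℕ) = 2 ^ (2 * 1) := by norm_num
      _ ≤ 2 ^ (2 * n) := Nat.pow_le_pow_right Nat.two_pos (by omega)
  have h3 : 2 ^ (2 * n) * 2 ≤ 2 ^ (3 * n) := by
    rw [← pow_succ]
    exact Nat.pow_le_pow_right Nat.two_pos (by omega)
  omega

/-- **Sanity / non-triviality of the entropy game.**  There is `K₀` (the constant of
`eval_eq_of_entropyGame` at rate `3`) such that graphs admitting an entropy-`K₀` game have the
same number of edges: the all-pairs probe-count circuits `[t ≤ 2|E|]`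
(`hasSymCircuit_probeCount`, size `n² + 3 ≤ 2^{3n}`, `Sym(Fin n)`-symmetric) must agree on the two
adjacency matrices.  So `EntropyGame K` is a genuine, strictly isomorphism-coarser similarity — not
satisfiable for trivial reasons. -/
theorem card_edgeFinset_eq_of_entropyGame : ∃ K₀ : ℕ, ∀ (n : ℕ) (G H : SimpleGraph (Fin n))
    [DecidableRel G.Adj] [DecidableRel H.Adj], Nonempty (EntropyGame K₀ G H) →
    G.edgeFinset.card = H.edgeFinset.card := by
  obtain ⟨K, hK⟩ := eval_eq_of_entropyGame 3
  refine ⟨K, fun n G H _ _ hg => ?_⟩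
  rcases Nat.eq_zero_or_pos n with rfl | hn
  · have hG : G.edgeFinset = ∅ :=
      Finset.eq_empty_of_forall_notMem fun e _ => Sym2.ind (f := fun _ => False)
        (fun a _ => IsEmpty.false a) e
    have hH : H.edgeFinset = ∅ :=
      Finset.eq_empty_of_forall_notMem fun e _ => Sym2.ind (f := fun _ => False)
        (fun a _ => IsEmpty.false a) e
    rw [hG, hH]
  · have key : ∀ t : ℕ,
        decide (t ≤ 2 * G.edgeFinset.card) = decide (t ≤ 2 * H.edgeFinset.card) := by
      intro t
      obtain ⟨C, hB, hsize, hsymC, hcomp⟩ :=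
        hasSymCircuit_probeCount (pairProbe n) t Set.univ (fun ρ _ => pairProbe_equivariant ρ)
      have hsz : C.size ≤ 2 ^ (3 * n) := hsize.trans (sq_add_three_le_two_pow hn)
      have h := hK n G H hg C hB hsymC hsz
      have hG : C.eval (adjInput G) = decide (t ≤ probeCount (pairProbe n) (adjInput G)) := hcomp _
      have hH : C.eval (adjInput H) = decide (t ≤ probeCount (pairProbe n) (adjInput H)) := hcomp _
      rw [hG, hH, probeCount_pairProbe, probeCount_pairProbe] at h
      exact h
    have h1 := (decide_eq_decide.1 (key (2 * G.edgeFinset.card))).1 le_rfl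
    have h2 := (decide_eq_decide.1 (key (2 * H.edgeFinset.card))).2 le_rfl
    omega

end CosetGame

end Summit.PneNP.PneNP.Theorems
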